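import Mathlib
import Literature.MathematicalPhysics.QuantumFieldTheory.Balaban1983to89.B9

/-! # `Balaban1983to89.B9FrakGPos` — the clause "Theorem 3.11 holds for the propagator 𝔊" of B9 Theorem 3.13,
kernel-checked at operator level: refuted as printed, repaired on the constraint subspace

CITATION HEADER. Supports GAPS row G-adv8-3 (adversarial reader `b2b-balaban-adv8-g2`, cell pub-balaban) on
T. Balaban, *Propagators for lattice gauge theories in a background field*, Commun. Math. Phys. 99 (1985) 389–434
[`Balaban1985BackgroundPropagators`], Theorem 3.13 (p. 426, render `…-background-propagators-p038-x2.png`), verbatim: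
"If an external gauge field configuration U satisfies the regularity conditions (3.35), (3.36) for α₀ sufficiently
small, then Theorems 3.3, 3.10, 3.11 hold for the propagator 𝔊, with the exception of the inequality in (3.42) involving
the covariant Laplace operator."  Theorem 3.11 (p. 416, render `…-p028-x2.png`): "… the operators Δ′_a, G′,
(Q′G′²Q′*)^{−1}, Δ_a, G are positive definite", and its proof fixes the meaning of the words: "It is a symmetric and
invertible operator, so if it is not positive, then there exists A₀ ≠ 0, λ₀ > 0 such that GA₀ = −λ₀A₀."
WHAT IS PRINTED (pp. 425–426, renders `…-p037-x2.png`, `…-p038-x2.png`).  (3.147): 𝔓 = I − G₁Q*(QG₁Q*)^{−1}Q − G₁DRD*.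
"It is easy to verify explicitly properties of the operator 𝔓, i.e. Q𝔓 = 0, RD*𝔓 = 0, 𝔓² = 𝔓, if 𝔓^{[*]} denotes an
adjoint of 𝔓 in the Hilbert space with the scalar product ⟨A, G₁^{−1}A′⟩, then 𝔓^{[*]} = G₁𝔓*G₁^{−1} = G₁(I −
Q*(QG₁Q*)^{−1}QG₁ − DRD*G₁)G₁^{−1} = 𝔓. Thus 𝔓 is an orthogonal projection in the Hilbert space onto a subspace contained
in {A : QA = 0, RD*A = 0}. If we take A₀ from the last subspace, then 𝔓A₀ = A₀ by (3.147), hence the range of 𝔓 is equal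
to it. Verifying the above properties we need to know only the identities (3.124) and RD*G₁DR = R."  (3.148) DEFINES 𝔊 as
the covariance of the constrained Gaussian integral Z^{−1}∫dA δ(QA)δ_R(RD*A) exp[−½⟨A,(Δ_π + Δ^{(2)}_π)A⟩ + ⟨A,J⟩] =
exp ½⟨J,𝔊J⟩.  (3.153): 𝔊 = G₁ − G₁DRD*G₁ − G₁Q*(QG₁Q*)^{−1}QG₁ = G₁𝔓* = 𝔓G₁ (its derivation from (3.150), (3.152) is
kernel-checked as `B9.frakG_3153`).

TYPING.  The operators are real-linear maps between three real inner-product spaces: `E` (vector fields A, J on the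
fine lattice — the space 𝔊 acts on), `F` (fields on the coarse lattice, the target of Q), `S` (scalar fields, the
source of D); g = G₁ : E → E, q = Q : E → F, qs = Q* : F → E, c = (QG₁Q*)^{−1} : F → F, d = D : S → E, ds = D* : E → S,
r = R : S → S.  Hypotheses are EXACTLY the identities the text says it uses ("we need to know only the identities
(3.124) and RD*G₁DR = R", p. 425), as operator identities: (3.124) p. 420 "RD*GQ* = 0, hence QGDR = 0" taken for G₁
(`h124R` : RD*G₁Q* = 0, `h124Q` : QG₁DR = 0), `hc`/`hc'` : (QG₁Q*)^{−1} is a right/left inverse of QG₁Q*, `hR` :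
RD*G₁DR = R (p. 425); and, where an inner product is involved, "Q*, D* are the adjoints of Q, D", "R,
(QG₁Q*)^{−1}, G₁ symmetric", "G₁ ≥ 0" / "G₁ positive definite" (Theorem 3.12: Theorem 3.11 holds for G₁).  At
E = F = S the definitions are the ring expressions `B9.frakP`, `B9.frakPstar` of the sibling module (`frakP_eq_B9`,
`frakPstar_eq_B9`, `frakG_eq_B9`), so this file and `B9.frakG_3153` speak about the same 𝔊.

WHAT THIS FILE CERTIFIES (kernel; value = one located-and-repaired gap of the printed text, NOT summit progress).
1. REFUTATION OF THE CLAUSE AS PRINTED (G-adv8-3): `frakPstar_qs` 𝔓*Q* = 0, hence `frakG_qs` 𝔊Q*ω = G₁𝔓*Q*ω = 0 for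
   every ω; so as soon as Q*ω ≠ 0 for some coarse field ω (Q* is injective whenever QQ* is invertible) 𝔊 is NOT
   injective (`not_injective_frakG`), hence not "symmetric and invertible … positive", and the quadratic form ⟨J, 𝔊J⟩
   vanishes at J = Q*ω ≠ 0 (`not_posDef_frakG`).  Exactly: `ker_frakPstar`/`ker_frakG` — ker 𝔊 = range Q* + range DR (G₁ injective),
   from the four identities alone.
2. THE MECHANISM: `inner_frakG_eq` — ⟨J, 𝔊J⟩ = ⟨𝔓*J, G₁𝔓*J⟩ for every J (no symmetry of G₁ or of (QG₁Q*)^{−1} is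
   needed; only Q ↔ Q*, D ↔ D* adjoint, R symmetric and the four identities), whence `inner_frakG_nonneg`: 𝔊 ≥ 0.
3. THE REPAIR (the reading downstream can use — by the consumer census of GAPS G-adv8-3, CMP 122 p. 295 (117) and
   p. 296 invoke Theorem 3.13 only for norm bounds of 𝔊, and (3.148) integrates over exactly this surface):
   `frakG_pos_on_constraint` — for J ≠ 0 with QJ = 0 and RD*J = 0, ⟨J, 𝔊J⟩ > 0; `q_frakG`, `rds_frakG` — 𝔊 maps E
   into V := {A : QA = 0, RD*A = 0} (= range 𝔓, `range_frakP`, the printed "the range of 𝔓 is equal to it");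
   `frakG_symm` — 𝔊 is symmetric; `eq_zero_of_frakG_eq_zero`, `frakGOn_injective`, `frakGOn_bijective` — 𝔊↾V
   (`frakGOn`, an endomorphism of `constraintSubspace`) is injective, and invertible in finite dimension: literally a
   "symmetric and invertible … positive" operator ON V.  Packaged: `PosDefOnConstraint` + `posDefOnConstraint_frakG` =
   "Theorem 3.11 holds for 𝔊 on {A : QA = 0, RD*A = 0}", the reading under which the clause is TRUE.  CONSEQUENCE
   for the DAG: the abstract carrier `PosDefK i (GG i) U` of `B9.Thm313Printed` has to be bound to positivity ON THIS
   SUBSPACE, not on all A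
   (G-adv8-3, ACTION for the `DagBinding` carver `PrintedCarriers9.PosDefK` / `B9Leaf.t313`); for `B9.Thm312Printed`
   (G, G₁: genuinely invertible, (3.122), (3.128)) the full-space reading stands.
4. The printed p. 425 facts Q𝔓 = 0, RD*𝔓 = 0, 𝔓² = 𝔓, G₁𝔓* = 𝔓G₁, range 𝔓 = V, re-checked here over the three spaces
   (`q_comp_frakP`, `rds_comp_frakP`, `frakP_comp_frakP`, `g_comp_frakPstar`, `range_frakP`); `B9` has the first three
   over one ring.
NOT HERE: (3.152) and (3.152) ⇒ (3.124) (kernel-checked / certified in `B9`, GAPS C-B9-13); finite-dimensionality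
(every statement below is dimension-free); the random-walk and decay clauses of Theorem 3.13 (Theorems 3.3, 3.10 for 𝔊),
which are untouched by this row.  Elementary linear algebra; [folklore]. -/

namespace Literature.MathematicalPhysics.QuantumFieldTheory.Balaban1983to89.B9FrakGPos

variable {E F S : Type*} [NormedAddCommGroup E] [InnerProductSpace ℝ E] [NormedAddCommGroup F]
  [InnerProductSpace ℝ F] [NormedAddCommGroup S] [InnerProductSpace ℝ S]

variable (g : E →ₗ[ℝ] E) (q : E →ₗ[ℝ] F) (qs : F →ₗ[ℝ] E) (c : F →ₗ[ℝ] F) (d : S →ₗ[ℝ] E) (ds : E →ₗ[ℝ] S)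
  (r : S →ₗ[ℝ] S)

/-! ### The operators (3.147), (3.153) -/

/-- The operator 𝔓 of **(3.147)** p. 425 [PDF 37]: 𝔓 = I − G₁Q*(QG₁Q*)^{−1}Q − G₁DRD*, a linear map of the space E of
vector fields (g = G₁, q = Q, qs = Q*, c = (QG₁Q*)^{−1}, d = D, ds = D*, r = R). [cite: Balaban1985BackgroundPropagators, (3.147) p.425] -/
def frakP : E →ₗ[ℝ] E := LinearMap.id - g ∘ₗ qs ∘ₗ c ∘ₗ q - g ∘ₗ d ∘ₗ r ∘ₗ ds

/-- The operator 𝔓* of **(3.153)** p. 426 [PDF 38] (the transpose of 𝔓; the text's G₁^{−1}-adjoint is 𝔓^{[*]} =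
G₁𝔓*G₁^{−1}): 𝔓* = I − Q*(QG₁Q*)^{−1}QG₁ − DRD*G₁. [cite: Balaban1985BackgroundPropagators, (3.153) p.426] -/
def frakPstar : E →ₗ[ℝ] E := LinearMap.id - qs ∘ₗ c ∘ₗ q ∘ₗ g - d ∘ₗ r ∘ₗ ds ∘ₗ g

/-- The propagator 𝔊 = G₁𝔓* of **(3.153)** p. 426 [PDF 38] (= the covariance (3.148) of the constrained Gaussian
integral, by the text). [cite: Balaban1985BackgroundPropagators, (3.153) p.426] -/
def frakG : E →ₗ[ℝ] E := g ∘ₗ frakPstar g q qs c d ds r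

/-- Pointwise form of (3.147). [cite: Balaban1985BackgroundPropagators, (3.147) p.425] -/
theorem frakP_apply (x : E) : frakP g q qs c d ds r x = x - g (qs (c (q x))) - g (d (r (ds x))) := rfl

/-- Pointwise form of 𝔓* in (3.153). [cite: Balaban1985BackgroundPropagators, (3.153) p.426] -/
theorem frakPstar_apply (x : E) : frakPstar g q qs c d ds r x = x - qs (c (q (g x))) - d (r (ds (g x))) := rfl

/-- Pointwise form of 𝔊 = G₁𝔓*. [cite: Balaban1985BackgroundPropagators, (3.153) p.426] -/
theorem frakG_apply (x : E) : frakG g q qs c d ds r x = g (frakPstar g q qs c d ds r x) := rfl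

/-- **(3.153), last equality / p. 425 "𝔓^{[*]} = G₁𝔓*G₁^{−1} = 𝔓"** (kernel-checked): G₁𝔓* = 𝔓G₁ — pure algebra, no
hypothesis. [cite: Balaban1985BackgroundPropagators, (3.153) p.426] -/
theorem g_comp_frakPstar : g ∘ₗ frakPstar g q qs c d ds r = frakP g q qs c d ds r ∘ₗ g := by
  ext x
  simp [frakP_apply, frakPstar_apply, map_sub]

/-- 𝔊 = 𝔓G₁ pointwise. [cite: Balaban1985BackgroundPropagators, (3.153) p.426] -/
theorem frakG_apply' (x : E) : frakG g q qs c d ds r x = frakP g q qs c d ds r (g x) := by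
  simp [frakG_apply, frakP_apply, frakPstar_apply, map_sub]

/-! ### p. 425: Q𝔓 = 0, RD*𝔓 = 0, 𝔓² = 𝔓, range 𝔓 = {A : QA = 0, RD*A = 0} -/

/-- **p. 425, Q𝔓 = 0** (kernel-checked) from (QG₁Q*)(QG₁Q*)^{−1} = I and QG₁DR = 0 ((3.124) for G₁). [cite: Balaban1985BackgroundPropagators, p.425] -/
theorem q_comp_frakP (hc : q ∘ₗ g ∘ₗ qs ∘ₗ c = LinearMap.id) (h124Q : q ∘ₗ g ∘ₗ d ∘ₗ r = 0) :
    q ∘ₗ frakP g q qs c d ds r = 0 := by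
  ext x
  have h1 : q (g (qs (c (q x)))) = q x := by simpa using LinearMap.congr_fun hc (q x)
  have h2 : q (g (d (r (ds x)))) = 0 := by simpa using LinearMap.congr_fun h124Q (ds x)
  simp [frakP_apply, map_sub, h1, h2]

/-- **p. 425, RD*𝔓 = 0** (kernel-checked) from RD*G₁Q* = 0 ((3.124) for G₁) and RD*G₁DR = R. [cite: Balaban1985BackgroundPropagators, p.425] -/
theorem rds_comp_frakP (h124R : r ∘ₗ ds ∘ₗ g ∘ₗ qs = 0) (hR : r ∘ₗ ds ∘ₗ g ∘ₗ d ∘ₗ r = r) :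
    (r ∘ₗ ds) ∘ₗ frakP g q qs c d ds r = 0 := by
  ext x
  have h1 : r (ds (g (qs (c (q x))))) = 0 := by simpa using LinearMap.congr_fun h124R (c (q x))
  have h2 : r (ds (g (d (r (ds x))))) = r (ds x) := by simpa using LinearMap.congr_fun hR (ds x)
  simp [frakP_apply, map_sub, h1, h2]

/-- **p. 425, 𝔓² = 𝔓** (kernel-checked) from Q𝔓 = 0 and RD*𝔓 = 0. [cite: Balaban1985BackgroundPropagators, p.425] -/
theorem frakP_comp_frakP (hc : q ∘ₗ g ∘ₗ qs ∘ₗ c = LinearMap.id) (h124Q : q ∘ₗ g ∘ₗ d ∘ₗ r = 0)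
    (h124R : r ∘ₗ ds ∘ₗ g ∘ₗ qs = 0) (hR : r ∘ₗ ds ∘ₗ g ∘ₗ d ∘ₗ r = r) :
    frakP g q qs c d ds r ∘ₗ frakP g q qs c d ds r = frakP g q qs c d ds r := by
  ext x
  have h1 : q (frakP g q qs c d ds r x) = 0 := by
    simpa using LinearMap.congr_fun (q_comp_frakP g q qs c d ds r hc h124Q) x
  have h2 : r (ds (frakP g q qs c d ds r x)) = 0 := by
    simpa using LinearMap.congr_fun (rds_comp_frakP g q qs c d ds r h124R hR) x
  rw [LinearMap.comp_apply, frakP_apply g q qs c d ds r (frakP g q qs c d ds r x), h1, h2]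
  simp

/-- **p. 425, "the range of 𝔓 is equal to" {A : QA = 0, RD*A = 0}** (kernel-checked): range 𝔓 = ker Q ⊓ ker RD*.
[cite: Balaban1985BackgroundPropagators, p.425] -/
theorem range_frakP (hc : q ∘ₗ g ∘ₗ qs ∘ₗ c = LinearMap.id) (h124Q : q ∘ₗ g ∘ₗ d ∘ₗ r = 0)
    (h124R : r ∘ₗ ds ∘ₗ g ∘ₗ qs = 0) (hR : r ∘ₗ ds ∘ₗ g ∘ₗ d ∘ₗ r = r) :
    LinearMap.range (frakP g q qs c d ds r) = LinearMap.ker q ⊓ LinearMap.ker (r ∘ₗ ds) := by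
  apply le_antisymm
  · rintro _ ⟨x, rfl⟩
    refine ⟨?_, ?_⟩
    · simpa using LinearMap.congr_fun (q_comp_frakP g q qs c d ds r hc h124Q) x
    · simpa using LinearMap.congr_fun (rds_comp_frakP g q qs c d ds r h124R hR) x
  · rintro y ⟨hy1, hy2⟩
    have e1 : q y = 0 := by simpa using hy1
    have e2 : r (ds y) = 0 := by simpa using hy2
    exact ⟨y, by simp [frakP_apply, e1, e2]⟩

/-! ### 𝔓*Q* = 0, 𝔓*DR = 0, ker 𝔓* = ker 𝔊 = range Q* + range DR — the clause as printed is false -/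

/-- 𝔓*Q* = 0 (kernel-checked) from (QG₁Q*)^{−1}(QG₁Q*) = I and RD*G₁Q* = 0 — a consequence of the printed 𝔓*
(3.153) not stated in the text. [folklore] -/
theorem frakPstar_qs (hc' : c ∘ₗ q ∘ₗ g ∘ₗ qs = LinearMap.id) (h124R : r ∘ₗ ds ∘ₗ g ∘ₗ qs = 0) (ω : F) :
    frakPstar g q qs c d ds r (qs ω) = 0 := by
  have h1 : c (q (g (qs ω))) = ω := by simpa using LinearMap.congr_fun hc' ω
  have h2 : r (ds (g (qs ω))) = 0 := by simpa using LinearMap.congr_fun h124R ω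
  simp [frakPstar_apply, h1, h2]

/-- 𝔓*DR = 0 (kernel-checked) from QG₁DR = 0 and RD*G₁DR = R — a consequence of the printed 𝔓* (3.153) not stated in
the text. [folklore] -/
theorem frakPstar_dr (h124Q : q ∘ₗ g ∘ₗ d ∘ₗ r = 0) (hR : r ∘ₗ ds ∘ₗ g ∘ₗ d ∘ₗ r = r) (s : S) :
    frakPstar g q qs c d ds r (d (r s)) = 0 := by
  have h1 : q (g (d (r s))) = 0 := by simpa using LinearMap.congr_fun h124Q s
  have h2 : r (ds (g (d (r s)))) = r s := by simpa using LinearMap.congr_fun hR s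
  simp [frakPstar_apply, h1, h2]

/-- ker 𝔓* = range Q* + range DR (kernel-checked; from the four identities only). [folklore] -/
theorem ker_frakPstar (hc' : c ∘ₗ q ∘ₗ g ∘ₗ qs = LinearMap.id) (h124Q : q ∘ₗ g ∘ₗ d ∘ₗ r = 0)
    (h124R : r ∘ₗ ds ∘ₗ g ∘ₗ qs = 0) (hR : r ∘ₗ ds ∘ₗ g ∘ₗ d ∘ₗ r = r) :
    LinearMap.ker (frakPstar g q qs c d ds r) = LinearMap.range qs ⊔ LinearMap.range (d ∘ₗ r) := by
  apply le_antisymm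
  · intro J hJ
    rw [LinearMap.mem_ker, frakPstar_apply, sub_sub, sub_eq_zero] at hJ
    rw [hJ]
    exact Submodule.add_mem_sup (LinearMap.mem_range_self qs _) (LinearMap.mem_range_self (d ∘ₗ r) (ds (g J)))
  · apply sup_le
    · rintro _ ⟨ω, rfl⟩
      exact frakPstar_qs g q qs c d ds r hc' h124R ω
    · rintro _ ⟨s, rfl⟩
      exact frakPstar_dr g q qs c d ds r h124Q hR s

/-- 𝔊Q* = 0 (kernel-checked): every Q*ω is in the kernel of 𝔊 (not stated in the text). [folklore] -/
theorem frakG_qs (hc' : c ∘ₗ q ∘ₗ g ∘ₗ qs = LinearMap.id) (h124R : r ∘ₗ ds ∘ₗ g ∘ₗ qs = 0) (ω : F) :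
    frakG g q qs c d ds r (qs ω) = 0 := by
  rw [frakG_apply, frakPstar_qs g q qs c d ds r hc' h124R ω, map_zero]

/-- 𝔊DR = 0 (kernel-checked; not stated in the text). [folklore] -/
theorem frakG_dr (h124Q : q ∘ₗ g ∘ₗ d ∘ₗ r = 0) (hR : r ∘ₗ ds ∘ₗ g ∘ₗ d ∘ₗ r = r) (s : S) :
    frakG g q qs c d ds r (d (r s)) = 0 := by
  rw [frakG_apply, frakPstar_dr g q qs c d ds r h124Q hR s, map_zero]

/-- ker 𝔊 = range Q* + range DR for G₁ injective (kernel-checked). [folklore] -/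
theorem ker_frakG (hg : LinearMap.ker g = ⊥) (hc' : c ∘ₗ q ∘ₗ g ∘ₗ qs = LinearMap.id)
    (h124Q : q ∘ₗ g ∘ₗ d ∘ₗ r = 0) (h124R : r ∘ₗ ds ∘ₗ g ∘ₗ qs = 0) (hR : r ∘ₗ ds ∘ₗ g ∘ₗ d ∘ₗ r = r) :
    LinearMap.ker (frakG g q qs c d ds r) = LinearMap.range qs ⊔ LinearMap.range (d ∘ₗ r) := by
  rw [frakG, LinearMap.ker_comp_of_ker_eq_bot _ hg]
  exact ker_frakPstar g q qs c d ds r hc' h124Q h124R hR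

/-- **G-adv8-3, the clause "Theorem 3.11 holds for 𝔊" is false as printed, I** (kernel-checked): if Q* ≠ 0 then 𝔊 is
not injective — so not "a symmetric and invertible operator" with positive spectrum (the printed meaning of positive
definite, proof of Thm 3.11 p. 416).  NOT PRINTED — this is the cell's objection to the printed clause (Thm 3.13,
p. 426), derived from the printed identities only. [folklore] -/
theorem not_injective_frakG (hc' : c ∘ₗ q ∘ₗ g ∘ₗ qs = LinearMap.id) (h124R : r ∘ₗ ds ∘ₗ g ∘ₗ qs = 0)
    (hQ : ∃ ω : F, qs ω ≠ 0) : ¬ Function.Injective (frakG g q qs c d ds r) := by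
  obtain ⟨ω, hω⟩ := hQ
  intro h
  exact hω (h (by rw [frakG_qs g q qs c d ds r hc' h124R ω, map_zero]))

/-- **G-adv8-3, the clause is false as printed, II** (kernel-checked): if Q* ≠ 0 the quadratic form ⟨J, 𝔊J⟩ is not
positive definite on the space of all J (it vanishes at J = Q*ω ≠ 0).  NOT PRINTED — objection to the printed
clause (Thm 3.13, p. 426), from the printed identities only. [folklore] -/
theorem not_posDef_frakG (hc' : c ∘ₗ q ∘ₗ g ∘ₗ qs = LinearMap.id) (h124R : r ∘ₗ ds ∘ₗ g ∘ₗ qs = 0)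
    (hQ : ∃ ω : F, qs ω ≠ 0) : ¬ ∀ J : E, J ≠ 0 → 0 < inner ℝ J (frakG g q qs c d ds r J) := by
  obtain ⟨ω, hω⟩ := hQ
  intro h
  have h0 := h (qs ω) hω
  rw [frakG_qs g q qs c d ds r hc' h124R ω, inner_zero_right] at h0
  exact lt_irrefl 0 h0

/-! ### The mechanism ⟨J, 𝔊J⟩ = ⟨𝔓*J, G₁𝔓*J⟩, positivity, and the repair on {A : QA = 0, RD*A = 0} -/

/-- Adjointness turned around: Q* adjoint to Q gives ⟨Q*a, z⟩ = ⟨a, Qz⟩. [folklore] -/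
theorem inner_adj_symm {q : E →ₗ[ℝ] F} {qs : F →ₗ[ℝ] E}
    (hq : ∀ (x : E) (a : F), inner ℝ (q x) a = inner ℝ x (qs a)) (a : F) (z : E) :
    inner ℝ (qs a) z = inner ℝ a (q z) := by
  rw [real_inner_comm z (qs a), ← hq, real_inner_comm a (q z)]

/-- 𝔊 maps into ker Q (kernel-checked): Q𝔊 = Q𝔓G₁ = 0, from the printed Q𝔓 = 0 (p. 425) and 𝔊 = 𝔓G₁ (3.153).
[folklore] -/
theorem q_frakG (hc : q ∘ₗ g ∘ₗ qs ∘ₗ c = LinearMap.id) (h124Q : q ∘ₗ g ∘ₗ d ∘ₗ r = 0) (J : E) :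
    q (frakG g q qs c d ds r J) = 0 := by
  rw [frakG_apply']
  simpa using LinearMap.congr_fun (q_comp_frakP g q qs c d ds r hc h124Q) (g J)

/-- 𝔊 maps into ker RD* (kernel-checked): RD*𝔊 = RD*𝔓G₁ = 0, from the printed RD*𝔓 = 0 (p. 425) and 𝔊 = 𝔓G₁
(3.153). [folklore] -/
theorem rds_frakG (h124R : r ∘ₗ ds ∘ₗ g ∘ₗ qs = 0) (hR : r ∘ₗ ds ∘ₗ g ∘ₗ d ∘ₗ r = r) (J : E) :
    r (ds (frakG g q qs c d ds r J)) = 0 := by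
  rw [frakG_apply']
  simpa using LinearMap.congr_fun (rds_comp_frakP g q qs c d ds r h124R hR) (g J)

/-- **The mechanism** (kernel-checked): ⟨J, 𝔊J⟩ = ⟨𝔓*J, G₁𝔓*J⟩ for every J, from Q ↔ Q* and D ↔ D* adjoint, R
symmetric, and the four identities (no symmetry of G₁ or (QG₁Q*)^{−1} needed).  Proof: J − 𝔓*J = Q*a + DRm and
𝔊J ∈ ker Q ∩ ker RD*. [folklore] -/
theorem inner_frakG_eq (hq : ∀ (x : E) (a : F), inner ℝ (q x) a = inner ℝ x (qs a))
    (hd : ∀ (s : S) (x : E), inner ℝ (d s) x = inner ℝ s (ds x))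
    (hr : ∀ s t : S, inner ℝ (r s) t = inner ℝ s (r t))
    (hc : q ∘ₗ g ∘ₗ qs ∘ₗ c = LinearMap.id) (h124Q : q ∘ₗ g ∘ₗ d ∘ₗ r = 0)
    (h124R : r ∘ₗ ds ∘ₗ g ∘ₗ qs = 0) (hR : r ∘ₗ ds ∘ₗ g ∘ₗ d ∘ₗ r = r) (J : E) :
    inner ℝ J (frakG g q qs c d ds r J)
      = inner ℝ (frakPstar g q qs c d ds r J) (g (frakPstar g q qs c d ds r J)) := by
  have h1 : q (frakG g q qs c d ds r J) = 0 := q_frakG g q qs c d ds r hc h124Q J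
  have h2 : r (ds (frakG g q qs c d ds r J)) = 0 := rds_frakG g q qs c d ds r h124R hR J
  have e : J = frakPstar g q qs c d ds r J + qs (c (q (g J))) + d (r (ds (g J))) := by
    rw [frakPstar_apply]; abel
  have t1 : inner ℝ (qs (c (q (g J)))) (frakG g q qs c d ds r J) = 0 := by
    rw [inner_adj_symm hq, h1, inner_zero_right]
  have t2 : inner ℝ (d (r (ds (g J)))) (frakG g q qs c d ds r J) = 0 := by
    rw [hd, hr, h2, inner_zero_right]
  calc inner ℝ J (frakG g q qs c d ds r J)
      = inner ℝ (frakPstar g q qs c d ds r J + qs (c (q (g J))) + d (r (ds (g J))))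
          (frakG g q qs c d ds r J) := by rw [← e]
    _ = inner ℝ (frakPstar g q qs c d ds r J) (frakG g q qs c d ds r J) := by
          rw [inner_add_left, inner_add_left, t1, t2, add_zero, add_zero]
    _ = inner ℝ (frakPstar g q qs c d ds r J) (g (frakPstar g q qs c d ds r J)) := by rw [frakG_apply]

/-- **𝔊 ≥ 0** (kernel-checked): ⟨J, 𝔊J⟩ ≥ 0 for every J when G₁ ≥ 0. [folklore] -/
theorem inner_frakG_nonneg (hq : ∀ (x : E) (a : F), inner ℝ (q x) a = inner ℝ x (qs a))
    (hd : ∀ (s : S) (x : E), inner ℝ (d s) x = inner ℝ s (ds x))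
    (hr : ∀ s t : S, inner ℝ (r s) t = inner ℝ s (r t))
    (hc : q ∘ₗ g ∘ₗ qs ∘ₗ c = LinearMap.id) (h124Q : q ∘ₗ g ∘ₗ d ∘ₗ r = 0)
    (h124R : r ∘ₗ ds ∘ₗ g ∘ₗ qs = 0) (hR : r ∘ₗ ds ∘ₗ g ∘ₗ d ∘ₗ r = r)
    (hg0 : ∀ x : E, 0 ≤ inner ℝ x (g x)) (J : E) : 0 ≤ inner ℝ J (frakG g q qs c d ds r J) := by
  rw [inner_frakG_eq g q qs c d ds r hq hd hr hc h124Q h124R hR J]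
  exact hg0 _

/-- On the constraint subspace 𝔓* is injective (kernel-checked): QJ = 0, RD*J = 0 and 𝔓*J = 0 force J = 0 (⟨J, J⟩ =
⟨QJ, a⟩ + ⟨RD*J, m⟩ = 0). [folklore] -/
theorem eq_zero_of_frakPstar_eq_zero (hq : ∀ (x : E) (a : F), inner ℝ (q x) a = inner ℝ x (qs a))
    (hd : ∀ (s : S) (x : E), inner ℝ (d s) x = inner ℝ s (ds x))
    (hr : ∀ s t : S, inner ℝ (r s) t = inner ℝ s (r t)) (J : E) (hQJ : q J = 0) (hRJ : r (ds J) = 0)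
    (h0 : frakPstar g q qs c d ds r J = 0) : J = 0 := by
  have e : J = qs (c (q (g J))) + d (r (ds (g J))) := by
    rw [frakPstar_apply, sub_sub, sub_eq_zero] at h0; exact h0
  have hJJ : inner ℝ J J = 0 := by
    calc inner ℝ J J = inner ℝ J (qs (c (q (g J))) + d (r (ds (g J)))) := by rw [← e]
      _ = inner ℝ J (qs (c (q (g J)))) + inner ℝ J (d (r (ds (g J)))) := inner_add_right _ _ _
      _ = 0 := by
          rw [← hq, hQJ, inner_zero_left, real_inner_comm (d (r (ds (g J)))) J, hd, hr, hRJ,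
            inner_zero_right, add_zero]
  exact inner_self_eq_zero.mp hJJ

/-- **THE REPAIR of G-adv8-3** (kernel-checked): on V = {A : QA = 0, RD*A = 0} — the surface δ(QA)δ_R(RD*A) of the
defining integral (3.148), = range 𝔓 — the form of 𝔊 is positive definite: QJ = 0, RD*J = 0, J ≠ 0 ⇒ ⟨J, 𝔊J⟩ > 0,
given G₁ positive definite (Thm 3.12), Q*/D* adjoint to Q/D, R symmetric and the four identities of p. 425.  NOT
PRINTED in this form — it is the repaired content of the clause "Theorem 3.11 holds for 𝔊" (Thm 3.13, p. 426).
[folklore] -/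
theorem frakG_pos_on_constraint (hq : ∀ (x : E) (a : F), inner ℝ (q x) a = inner ℝ x (qs a))
    (hd : ∀ (s : S) (x : E), inner ℝ (d s) x = inner ℝ s (ds x))
    (hr : ∀ s t : S, inner ℝ (r s) t = inner ℝ s (r t))
    (hc : q ∘ₗ g ∘ₗ qs ∘ₗ c = LinearMap.id) (h124Q : q ∘ₗ g ∘ₗ d ∘ₗ r = 0)
    (h124R : r ∘ₗ ds ∘ₗ g ∘ₗ qs = 0) (hR : r ∘ₗ ds ∘ₗ g ∘ₗ d ∘ₗ r = r)
    (hgpos : ∀ x : E, x ≠ 0 → 0 < inner ℝ x (g x)) (J : E) (hQJ : q J = 0) (hRJ : r (ds J) = 0)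
    (hJ : J ≠ 0) : 0 < inner ℝ J (frakG g q qs c d ds r J) := by
  rw [inner_frakG_eq g q qs c d ds r hq hd hr hc h124Q h124R hR J]
  refine hgpos _ fun h0 => hJ ?_
  exact eq_zero_of_frakPstar_eq_zero g q qs c d ds r hq hd hr J hQJ hRJ h0

/-- Turned-around adjointness for D: ⟨D*x, s⟩ = ⟨x, Ds⟩. [folklore] -/
theorem inner_adj_symm' {d : S →ₗ[ℝ] E} {ds : E →ₗ[ℝ] S}
    (hd : ∀ (s : S) (x : E), inner ℝ (d s) x = inner ℝ s (ds x)) (x : E) (s : S) :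
    inner ℝ (ds x) s = inner ℝ x (d s) := by
  rw [real_inner_comm s (ds x), ← hd, real_inner_comm x (d s)]

/-- 𝔓* is the transpose of 𝔓 (kernel-checked): ⟨𝔓x, y⟩ = ⟨x, 𝔓*y⟩, given Q*/D* adjoint to Q/D and G₁, (QG₁Q*)^{−1}, R
symmetric — the linear algebra behind p. 425's "𝔓^{[*]} = G₁𝔓*G₁^{−1}". [folklore] -/
theorem inner_frakP_left (hq : ∀ (x : E) (a : F), inner ℝ (q x) a = inner ℝ x (qs a))
    (hd : ∀ (s : S) (x : E), inner ℝ (d s) x = inner ℝ s (ds x))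
    (hg : ∀ x y : E, inner ℝ (g x) y = inner ℝ x (g y)) (hcs : ∀ a b : F, inner ℝ (c a) b = inner ℝ a (c b))
    (hr : ∀ s t : S, inner ℝ (r s) t = inner ℝ s (r t)) (x y : E) :
    inner ℝ (frakP g q qs c d ds r x) y = inner ℝ x (frakPstar g q qs c d ds r y) := by
  have e1 : inner ℝ (g (qs (c (q x)))) y = inner ℝ x (qs (c (q (g y)))) := by
    rw [hg, inner_adj_symm hq, hcs, hq]
  have e2 : inner ℝ (g (d (r (ds x)))) y = inner ℝ x (d (r (ds (g y)))) := by
    rw [hg, hd, hr, inner_adj_symm' hd]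
  rw [frakP_apply, frakPstar_apply, inner_sub_left, inner_sub_left, inner_sub_right, inner_sub_right, e1, e2]

/-- **𝔊 is symmetric** (kernel-checked): ⟨𝔊x, y⟩ = ⟨x, 𝔊y⟩ (G₁, (QG₁Q*)^{−1}, R symmetric, Q*/D* adjoint to Q/D) —
as a covariance (3.148) must be. [folklore] -/
theorem frakG_symm (hq : ∀ (x : E) (a : F), inner ℝ (q x) a = inner ℝ x (qs a))
    (hd : ∀ (s : S) (x : E), inner ℝ (d s) x = inner ℝ s (ds x))
    (hg : ∀ x y : E, inner ℝ (g x) y = inner ℝ x (g y)) (hcs : ∀ a b : F, inner ℝ (c a) b = inner ℝ a (c b))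
    (hr : ∀ s t : S, inner ℝ (r s) t = inner ℝ s (r t)) (x y : E) :
    inner ℝ (frakG g q qs c d ds r x) y = inner ℝ x (frakG g q qs c d ds r y) := by
  rw [frakG_apply g q qs c d ds r x, hg, real_inner_comm (g y) (frakPstar g q qs c d ds r x),
    ← inner_frakP_left g q qs c d ds r hq hd hg hcs hr (g y) x, real_inner_comm x (frakP g q qs c d ds r (g y)),
    ← frakG_apply' g q qs c d ds r y]

/-! ### 𝔊 on V = {A : QA = 0, RD*A = 0}: maps V into V, injective there, invertible there in finite dimension -/

/-- The constraint subspace V = {A : QA = 0, RD*A = 0} of p. 425 [PDF 37] (the surface of the δ-functions δ(QA)δ_R(RD*A)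
in (3.148); = range 𝔓 by `range_frakP`). [cite: Balaban1985BackgroundPropagators, p.425] -/
def constraintSubspace : Submodule ℝ E := LinearMap.ker q ⊓ LinearMap.ker (r ∘ₗ ds)

/-- Membership in V unfolded. [folklore] -/
theorem mem_constraintSubspace (x : E) : x ∈ constraintSubspace q ds r ↔ q x = 0 ∧ r (ds x) = 0 := by
  simp [constraintSubspace]

/-- 𝔊 maps E (a fortiori V) into V (kernel-checked). [folklore] -/
theorem frakG_mem_constraintSubspace (hc : q ∘ₗ g ∘ₗ qs ∘ₗ c = LinearMap.id) (h124Q : q ∘ₗ g ∘ₗ d ∘ₗ r = 0)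
    (h124R : r ∘ₗ ds ∘ₗ g ∘ₗ qs = 0) (hR : r ∘ₗ ds ∘ₗ g ∘ₗ d ∘ₗ r = r) (x : E) :
    frakG g q qs c d ds r x ∈ constraintSubspace q ds r :=
  (mem_constraintSubspace q ds r _).2 ⟨q_frakG g q qs c d ds r hc h124Q x, rds_frakG g q qs c d ds r h124R hR x⟩

/-- **𝔊 is injective on V** (kernel-checked): QJ = 0, RD*J = 0, 𝔊J = 0 ⇒ J = 0 (G₁ positive definite) — the
"invertible" half of the printed meaning of positive definite, on V. [folklore] -/
theorem eq_zero_of_frakG_eq_zero (hq : ∀ (x : E) (a : F), inner ℝ (q x) a = inner ℝ x (qs a))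
    (hd : ∀ (s : S) (x : E), inner ℝ (d s) x = inner ℝ s (ds x))
    (hr : ∀ s t : S, inner ℝ (r s) t = inner ℝ s (r t))
    (hc : q ∘ₗ g ∘ₗ qs ∘ₗ c = LinearMap.id) (h124Q : q ∘ₗ g ∘ₗ d ∘ₗ r = 0)
    (h124R : r ∘ₗ ds ∘ₗ g ∘ₗ qs = 0) (hR : r ∘ₗ ds ∘ₗ g ∘ₗ d ∘ₗ r = r)
    (hgpos : ∀ x : E, x ≠ 0 → 0 < inner ℝ x (g x)) (J : E) (hQJ : q J = 0) (hRJ : r (ds J) = 0)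
    (h0 : frakG g q qs c d ds r J = 0) : J = 0 := by
  by_contra hJ
  have h := frakG_pos_on_constraint g q qs c d ds r hq hd hr hc h124Q h124R hR hgpos J hQJ hRJ hJ
  rw [h0, inner_zero_right] at h
  exact lt_irrefl 0 h

/-- 𝔊↾V, the propagator as an endomorphism of the constraint subspace V (kernel-checked construction). [folklore] -/
def frakGOn (hc : q ∘ₗ g ∘ₗ qs ∘ₗ c = LinearMap.id) (h124Q : q ∘ₗ g ∘ₗ d ∘ₗ r = 0)
    (h124R : r ∘ₗ ds ∘ₗ g ∘ₗ qs = 0) (hR : r ∘ₗ ds ∘ₗ g ∘ₗ d ∘ₗ r = r) :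
    constraintSubspace q ds r →ₗ[ℝ] constraintSubspace q ds r :=
  (frakG g q qs c d ds r).restrict fun x _ => frakG_mem_constraintSubspace g q qs c d ds r hc h124Q h124R hR x

/-- 𝔊↾V acts as 𝔊. [folklore] -/
theorem frakGOn_coe_apply (hc : q ∘ₗ g ∘ₗ qs ∘ₗ c = LinearMap.id) (h124Q : q ∘ₗ g ∘ₗ d ∘ₗ r = 0)
    (h124R : r ∘ₗ ds ∘ₗ g ∘ₗ qs = 0) (hR : r ∘ₗ ds ∘ₗ g ∘ₗ d ∘ₗ r = r) (x : constraintSubspace q ds r) :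
    (frakGOn g q qs c d ds r hc h124Q h124R hR x : E) = frakG g q qs c d ds r x := rfl

/-- **𝔊↾V is injective** (kernel-checked). [folklore] -/
theorem frakGOn_injective (hq : ∀ (x : E) (a : F), inner ℝ (q x) a = inner ℝ x (qs a))
    (hd : ∀ (s : S) (x : E), inner ℝ (d s) x = inner ℝ s (ds x))
    (hr : ∀ s t : S, inner ℝ (r s) t = inner ℝ s (r t))
    (hc : q ∘ₗ g ∘ₗ qs ∘ₗ c = LinearMap.id) (h124Q : q ∘ₗ g ∘ₗ d ∘ₗ r = 0)
    (h124R : r ∘ₗ ds ∘ₗ g ∘ₗ qs = 0) (hR : r ∘ₗ ds ∘ₗ g ∘ₗ d ∘ₗ r = r)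
    (hgpos : ∀ x : E, x ≠ 0 → 0 < inner ℝ x (g x)) :
    Function.Injective (frakGOn g q qs c d ds r hc h124Q h124R hR) := by
  rw [injective_iff_map_eq_zero]
  intro x hx
  have hx' := (mem_constraintSubspace q ds r (x : E)).1 x.2
  have h0 : frakG g q qs c d ds r x = 0 := by
    have := congrArg Subtype.val hx
    simpa [frakGOn_coe_apply] using this
  exact Subtype.ext (eq_zero_of_frakG_eq_zero g q qs c d ds r hq hd hr hc h124Q h124R hR hgpos x hx'.1 hx'.2 h0)

/-- **In finite dimension 𝔊↾V is invertible** (kernel-checked): a symmetric (`frakG_symm`) invertible operator on V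
with ⟨x, 𝔊x⟩ > 0 on V ∖ {0} (`frakG_pos_on_constraint`) — literally "Theorem 3.11 holds for 𝔊" ON V, in the sense
the proof of Theorem 3.11 (p. 416) gives the words. [folklore] -/
theorem frakGOn_bijective [FiniteDimensional ℝ E]
    (hq : ∀ (x : E) (a : F), inner ℝ (q x) a = inner ℝ x (qs a))
    (hd : ∀ (s : S) (x : E), inner ℝ (d s) x = inner ℝ s (ds x))
    (hr : ∀ s t : S, inner ℝ (r s) t = inner ℝ s (r t))
    (hc : q ∘ₗ g ∘ₗ qs ∘ₗ c = LinearMap.id) (h124Q : q ∘ₗ g ∘ₗ d ∘ₗ r = 0)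
    (h124R : r ∘ₗ ds ∘ₗ g ∘ₗ qs = 0) (hR : r ∘ₗ ds ∘ₗ g ∘ₗ d ∘ₗ r = r)
    (hgpos : ∀ x : E, x ≠ 0 → 0 < inner ℝ x (g x)) :
    Function.Bijective (frakGOn g q qs c d ds r hc h124Q h124R hR) :=
  have hi := frakGOn_injective g q qs c d ds r hq hd hr hc h124Q h124R hR hgpos
  ⟨hi, LinearMap.injective_iff_surjective.mp hi⟩

/-! ### "Theorem 3.11 holds for 𝔊" in the form that is true -/

/-- The repaired reading of the clause "Theorem 3.11 holds for the propagator 𝔊" of Theorem 3.13: an operator G on E is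
POSITIVE DEFINITE ON THE CONSTRAINT SUBSPACE V = ker Q ⊓ ker RD* if it is symmetric, maps E into V, and ⟨x, Gx⟩ > 0
for every x ∈ V ∖ {0} (in finite dimension: G|_V is a symmetric invertible operator on V with positive spectrum, the
meaning of "positive definite" in the proof of Thm 3.11, p. 416).  NOT A PRINTED NOTION: the print says "Theorem 3.11
hold[s] for the propagator 𝔊" (Thm 3.13, p. 426); this predicate is the cell's repair (GAPS G-adv8-3) of that clause,
offered to the `DagBinding` carver as the binding of `PosDefK` at 𝔊. [folklore] -/
def PosDefOnConstraint (G : E →ₗ[ℝ] E) (q : E →ₗ[ℝ] F) (rds : E →ₗ[ℝ] S) : Prop :=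
  (∀ x y : E, inner ℝ (G x) y = inner ℝ x (G y)) ∧ (∀ x : E, q (G x) = 0 ∧ rds (G x) = 0) ∧
    ∀ x : E, q x = 0 → rds x = 0 → x ≠ 0 → 0 < inner ℝ x (G x)

/-- **Theorem 3.13, positivity clause, repaired** (kernel-checked): under the identities of p. 425 ((3.124) for G₁,
(QG₁Q*)^{−1} two-sided inverse, RD*G₁DR = R), Q*/D* adjoint to Q/D, R and (QG₁Q*)^{−1} symmetric, and G₁ symmetric
positive definite (Theorem 3.12), the propagator 𝔊 = G₁𝔓* is positive definite on {A : QA = 0, RD*A = 0} in the sense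
of `PosDefOnConstraint` — while `not_posDef_frakG` / `not_injective_frakG` show it is not on the whole space.  (The
clause as PRINTED is Thm 3.13, p. 426; this is its repaired content, kernel-checked.) [folklore] -/
theorem posDefOnConstraint_frakG (hq : ∀ (x : E) (a : F), inner ℝ (q x) a = inner ℝ x (qs a))
    (hd : ∀ (s : S) (x : E), inner ℝ (d s) x = inner ℝ s (ds x))
    (hg : ∀ x y : E, inner ℝ (g x) y = inner ℝ x (g y)) (hcs : ∀ a b : F, inner ℝ (c a) b = inner ℝ a (c b))
    (hr : ∀ s t : S, inner ℝ (r s) t = inner ℝ s (r t))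
    (hc : q ∘ₗ g ∘ₗ qs ∘ₗ c = LinearMap.id) (h124Q : q ∘ₗ g ∘ₗ d ∘ₗ r = 0)
    (h124R : r ∘ₗ ds ∘ₗ g ∘ₗ qs = 0) (hR : r ∘ₗ ds ∘ₗ g ∘ₗ d ∘ₗ r = r)
    (hgpos : ∀ x : E, x ≠ 0 → 0 < inner ℝ x (g x)) :
    PosDefOnConstraint (frakG g q qs c d ds r) q (r ∘ₗ ds) := by
  refine ⟨frakG_symm g q qs c d ds r hq hd hg hcs hr, fun x => ⟨q_frakG g q qs c d ds r hc h124Q x, ?_⟩, ?_⟩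
  · simpa using rds_frakG g q qs c d ds r h124R hR x
  · intro x hx1 hx2 hx3
    have hx2' : r (ds x) = 0 := by simpa using hx2
    exact frakG_pos_on_constraint g q qs c d ds r hq hd hr hc h124Q h124R hR hgpos x hx1 hx2' hx3

/-! ### Tie-in with the one-ring expressions of `B9` -/

/-- At E = F = S the operator 𝔓 here IS the ring expression `B9.frakP` in `Module.End ℝ E` (kernel-checked, by `rfl`
pointwise) — internal consistency of the two typings of (3.147). [folklore] -/
theorem frakP_eq_B9 (g q qs c d ds r : E →ₗ[ℝ] E) : frakP g q qs c d ds r = B9.frakP g q qs c d ds r :=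
  LinearMap.ext fun _ => rfl

/-- At E = F = S the operator 𝔓* here IS `B9.frakPstar` in `Module.End ℝ E` (kernel-checked) — internal consistency of
the two typings of (3.153). [folklore] -/
theorem frakPstar_eq_B9 (g q qs c d ds r : E →ₗ[ℝ] E) :
    frakPstar g q qs c d ds r = B9.frakPstar g q qs c d ds r :=
  LinearMap.ext fun _ => rfl

/-- At E = F = S the propagator 𝔊 here IS `G₁ * B9.frakPstar …`, the right-hand side of `B9.frakG_3153`
(kernel-checked) — so the two modules speak about the same 𝔊. [folklore] -/
theorem frakG_eq_B9 (g q qs c d ds r : E →ₗ[ℝ] E) : frakG g q qs c d ds r = g * B9.frakPstar g q qs c d ds r :=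
  LinearMap.ext fun _ => rfl

end Literature.MathematicalPhysics.QuantumFieldTheory.Balaban1983to89.B9FrakGPos
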